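import Literature.NumberTheory.LFunctions.MontgomeryVaughan2001LogDerivMeanSquare
import Mathlib.NumberTheory.LSeries.Deriv
import Mathlib.NumberTheory.LSeries.Dirichlet
import HarnessLib

/-!
# Montgomery–Vaughan 2001, toward Theorem 3: `F' = −F · P` and the window mean square of `P = Σ f(n)Λ(n)n^{-s}`

Support file (everything PROVED, no definitions, no named facts) for the discharge of
`Literature.NumberTheory.LFunctions.MontgomeryVaughan2001_thm3` (H. L. Montgomery, R. C. Vaughan,
*Mean values of multiplicative functions*, Period. Math. Hungar. 43 (2001), Theorem 3), following the
self-contained reproduction of the Montgomery–Vaughan argument in Roy–Vatwani 2019, §6.1 at `k = 1`.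

For `f : ℕ →*₀ ℂ` totally multiplicative with `|f(n)| ≤ 1` and `F(s) = Σ f(n) n^{-s}`:

* `f(n) log n = Σ_{d | n} f(d)Λ(d) f(n/d)` ("`Λ_F = fΛ`", Roy–Vatwani (eq:identity for f) at `k = 1`),
  hence on `Re s > 1`:  `F'(s) = −P(s) F(s)` with `P(s) = Σ f(n)Λ(n) n^{-s}`
  (`deriv_LSeries_eq_neg_mul`);
* the window mean square needed in the proof of MV Theorem 2 ("`∫_{T−1/2}^{T+1/2} |F'/F(1+α+it)|² dt
  ≪ α^{-1}` uniformly for `0 < α ≤ 1`", Roy–Vatwani §6.1, obtained there from MV's majorant principle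
  (15)): here PROVED directly for `P` by the Granville–Soundararajan device already used for `ζ'/ζ` in
  `MontgomeryVaughan2001LogDerivMeanSquare.lean` — Mellin–Plancherel for the coefficients
  `f(n)Λ(n)n^{-iT}` (`|·| ≤ Λ(n)`, partial sums `≤ ψ(y) ≤ 6y`):
  `∫_{T−1/2}^{T+1/2} |P(1+α+iy)|² dy ≤ 500/α` (`window_integral_norm_LSeries_mulVM_sq_le`).

No division by `F` is ever needed downstream (`|F'| = |F| |P|`).

## References
- [MontgomeryVaughan2001] H. L. Montgomery, R. C. Vaughan, *Mean values of multiplicative functions*,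
  Period. Math. Hungar. 43 (2001), §3 ((15) and the proof of Theorem 2) (not held; read through:)
- [RoyVatwani2019] A. Roy, A. Vatwani, *Zeros of partial sums of L-functions*, arXiv:1807.11093, §6.1,
  (eq:identity for f), (eq:(15) of MV)–(eq:intg bound) (arXiv pp. 13–14).
- [GranvilleSoundararajan2003] A. Granville, K. Soundararajan, *Decay of mean values of
  multiplicative functions*, Canad. J. Math. 55 (2003), §3b.
-/

noncomputable section

open Complex Real MeasureTheory Set Filter Finset

namespace Literature.NumberTheory.LFunctions.MontgomeryVaughan2001

open MellinPlancherel (psum)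
open scoped ArithmeticFunction.vonMangoldt

/-! ### The coefficients `f(n)Λ(n) n^{−iT}` -/

/-- `‖f(n)Λ(n) n^{−iT}‖ ≤ Λ(n)` when `|f| ≤ 1`. [folklore] -/
theorem norm_twistedFVM_le (f : ℕ →*₀ ℂ) (hf : ∀ n, ‖f n‖ ≤ 1) (T : ℝ) (n : ℕ) :
    ‖f n * (Λ n : ℂ) * (n : ℂ) ^ (-(T * I))‖ ≤ Λ n := by
  rw [mul_assoc, norm_mul, norm_twistedVM]
  calc ‖f n‖ * Λ n ≤ 1 * Λ n :=
        mul_le_mul_of_nonneg_right (hf n) ArithmeticFunction.vonMangoldt_nonneg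
    _ = Λ n := one_mul _

/-- `|∑_{n ≤ y} f(n)Λ(n) n^{−iT}| ≤ ψ(y)`. [folklore] -/
theorem norm_psum_twistedFVM_le_psi (f : ℕ →*₀ ℂ) (hf : ∀ n, ‖f n‖ ≤ 1) (T y : ℝ) :
    ‖psum (fun n => f n * (Λ n : ℂ) * (n : ℂ) ^ (-(T * I))) y‖ ≤ Chebyshev.psi y := by
  unfold psum
  rw [Chebyshev.psi_eq_sum_Icc]
  calc ‖∑ n ∈ Icc 1 ⌊y⌋₊, f n * (Λ n : ℂ) * (n : ℂ) ^ (-(T * I))‖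
      ≤ ∑ n ∈ Icc 1 ⌊y⌋₊, ‖f n * (Λ n : ℂ) * (n : ℂ) ^ (-(T * I))‖ := norm_sum_le _ _
    _ ≤ ∑ n ∈ Icc 1 ⌊y⌋₊, Λ n := Finset.sum_le_sum fun n _ => norm_twistedFVM_le f hf T n
    _ ≤ ∑ n ∈ Icc 0 ⌊y⌋₊, Λ n := by
        refine Finset.sum_le_sum_of_subset_of_nonneg (fun n hn => ?_)
          (fun _ _ _ => ArithmeticFunction.vonMangoldt_nonneg)
        simp only [Finset.mem_Icc] at hn ⊢
        exact ⟨by omega, hn.2⟩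

/-- `|∑_{n ≤ y} f(n)Λ(n) n^{−iT}| ≤ 6 y` for `y ≥ 1` (Chebyshev). [folklore] -/
theorem norm_psum_twistedFVM_le (f : ℕ →*₀ ℂ) (hf : ∀ n, ‖f n‖ ≤ 1) (T y : ℝ) (hy : 1 ≤ y) :
    ‖psum (fun n => f n * (Λ n : ℂ) * (n : ℂ) ^ (-(T * I))) y‖ ≤ 6 * y ^ (1 : ℝ) := by
  rw [Real.rpow_one]
  refine (norm_psum_twistedFVM_le_psi f hf T y).trans
    ((Chebyshev.psi_le_const_mul_self (by linarith)).trans ?_)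
  have h4 : Real.log 4 ≤ 2 := by
    have h2 : Real.log 4 = 2 * Real.log 2 := by
      rw [show (4:ℝ) = 2 ^ 2 by norm_num, Real.log_pow]; ring
    rw [h2]; linarith [Real.log_two_lt_d9]
  nlinarith

/-- `∑ |f(n)Λ(n)n^{−iT}| n^{−σ} < ∞` for `σ > 1`. [folklore] -/
theorem summable_norm_twistedFVM_div_rpow (f : ℕ →*₀ ℂ) (hf : ∀ n, ‖f n‖ ≤ 1) (T : ℝ) {σ : ℝ}
    (hσ : 1 < σ) :
    Summable fun n : ℕ => ‖f n * (Λ n : ℂ) * (n : ℂ) ^ (-(T * I))‖ / (n : ℝ) ^ σ := by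
  refine Summable.of_nonneg_of_le (fun n => by positivity) (fun n => ?_)
    (summable_norm_twistedVM_div_rpow T hσ)
  refine div_le_div_of_nonneg_right ?_ (by positivity)
  rw [norm_twistedVM]
  exact norm_twistedFVM_le f hf T n

/-- The twist shifts the variable: `term (fΛ n^{−iT}) s n = term (fΛ) (s + iT) n`. [folklore] -/
theorem term_twistedFVM_eq (f : ℕ →*₀ ℂ) (T : ℝ) (s : ℂ) (n : ℕ) :
    LSeries.term (fun n => f n * (Λ n : ℂ) * (n : ℂ) ^ (-(T * I))) s n =
      LSeries.term (fun n => f n * (Λ n : ℂ)) (s + T * I) n := by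
  rcases Nat.eq_zero_or_pos n with rfl | hn
  · simp
  · have hn0 : (n : ℂ) ≠ 0 := by exact_mod_cast hn.ne'
    rw [LSeries.term_of_ne_zero hn.ne', LSeries.term_of_ne_zero hn.ne', Complex.cpow_add _ _ hn0,
      Complex.cpow_neg]
    field_simp

/-- `Σ f(n)Λ(n) n^{−iT} n^{−s} = P(s + iT)`, `P(s) = Σ f(n)Λ(n)n^{-s}`. [folklore] -/
theorem LSeries_twistedFVM_eq (f : ℕ →*₀ ℂ) (T : ℝ) (s : ℂ) :
    LSeries (fun n => f n * (Λ n : ℂ) * (n : ℂ) ^ (-(T * I))) s =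
      LSeries (fun n => f n * (Λ n : ℂ)) (s + T * I) := by
  rw [LSeries, LSeries]
  exact tsum_congr fun n => term_twistedFVM_eq f T s n

/-- On the line `Re s = 1 + α`: `L(fΛ n^{−iT}, 1+α+iy) = P(1+α+i(T+y))`. [folklore] -/
theorem LSeries_twistedFVM_line (f : ℕ →*₀ ℂ) (T α y : ℝ) :
    LSeries (fun n => f n * (Λ n : ℂ) * (n : ℂ) ^ (-(T * I))) ((1 + α : ℝ) + y * I) =
      LSeries (fun n => f n * (Λ n : ℂ)) (1 + α + (T + y) * I) := by
  have hpt : ((1 + α : ℝ) : ℂ) + y * I + T * I = 1 + α + (T + y) * I := by push_cast; ring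
  rw [LSeries_twistedFVM_eq, hpt]

/-! ### The mean square of the partial sums and Mellin–Plancherel -/

/-- **The `Λ`-weighted mean square** for the twisted coefficients:
`∫ |∑_{n ≤ e^u} f(n)Λ(n) n^{−iT}|² e^{−2(1+α)u} du ≤ 18/α` (`α > 0`), from `ψ(y) ≤ 6y`.
[cite: GranvilleSoundararajan2003, §3b (display before (3.14))] -/
theorem meanSquare_twistedFVM_le (f : ℕ →*₀ ℂ) (hf : ∀ n, ‖f n‖ ≤ 1) (T : ℝ) {α : ℝ} (hα : 0 < α) :
    ∫ u : ℝ, ‖psum (fun n => f n * (Λ n : ℂ) * (n : ℂ) ^ (-(T * I))) (Real.exp u)‖ ^ 2 *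
        Real.exp (-(2 * (1 + α) * u)) ≤ 18 / α := by
  set a : ℕ → ℂ := fun n => f n * (Λ n : ℂ) * (n : ℂ) ^ (-(T * I)) with ha
  set F : ℝ → ℝ := (Set.Ici (0 : ℝ)).indicator (fun u => 36 * Real.exp (-(2 * α) * u)) with hF
  have hIoi : IntegrableOn (fun u => 36 * Real.exp (-(2 * α) * u)) (Set.Ioi (0 : ℝ)) :=
    (integrableOn_exp_mul_Ioi (by linarith : -(2 * α) < 0) 0).const_mul 36
  have hIci : IntegrableOn (fun u => 36 * Real.exp (-(2 * α) * u)) (Set.Ici (0 : ℝ)) :=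
    (integrableOn_Ici_iff_integrableOn_Ioi).2 hIoi
  have hFint : Integrable F := by
    rw [hF, integrable_indicator_iff measurableSet_Ici]
    exact hIci
  have hle : ∀ u : ℝ, ‖psum a (Real.exp u)‖ ^ 2 * Real.exp (-(2 * (1 + α) * u)) ≤ F u := by
    intro u
    by_cases hu : 0 ≤ u
    · rw [hF, Set.indicator_of_mem (Set.mem_Ici.2 hu)]
      have h1 : (1 : ℝ) ≤ Real.exp u := by simpa using Real.one_le_exp hu
      have hb := norm_psum_twistedFVM_le f hf T (Real.exp u) h1
      rw [Real.rpow_one] at hb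
      have hexp : (6 * Real.exp u) ^ 2 * Real.exp (-(2 * (1 + α) * u)) =
          36 * Real.exp (-(2 * α) * u) := by
        rw [mul_pow, sq (Real.exp u), ← Real.exp_add, mul_assoc, ← Real.exp_add]
        congr 1
        · norm_num
        · congr 1; ring
      calc ‖psum a (Real.exp u)‖ ^ 2 * Real.exp (-(2 * (1 + α) * u))
          ≤ (6 * Real.exp u) ^ 2 * Real.exp (-(2 * (1 + α) * u)) := by gcongr
        _ = 36 * Real.exp (-(2 * α) * u) := hexp
    · push Not at hu
      rw [hF, Set.indicator_of_notMem (by simpa using hu),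
        MellinPlancherel.psum_of_lt_one _ (by simpa using Real.exp_lt_one_iff.mpr hu)]
      simp
  have hnonneg : 0 ≤ᵐ[volume] fun u : ℝ => ‖psum a (Real.exp u)‖ ^ 2 * Real.exp (-(2 * (1 + α) * u)) :=
    Filter.Eventually.of_forall fun u => by positivity
  calc ∫ u : ℝ, ‖psum a (Real.exp u)‖ ^ 2 * Real.exp (-(2 * (1 + α) * u))
      ≤ ∫ u, F u := integral_mono_of_nonneg hnonneg hFint (Filter.Eventually.of_forall hle)
    _ = 36 * (1 / (2 * α)) := by
        rw [hF, integral_indicator measurableSet_Ici, integral_Ici_eq_integral_Ioi,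
          integral_const_mul, integral_exp_mul_Ioi (by linarith : -(2 * α) < 0) 0]
        congr 1
        simp only [mul_zero, Real.exp_zero]
        field_simp
    _ = 18 / α := by field_simp; ring

/-- **The weighted mean square of `P` on `Re s = 1 + α`, uniformly in the height `T`**:
`∫_ℝ |P(1 + α + i(T+y))|² / |1 + α + iy|² dy ≤ 36π/α` (`α > 0`), by Mellin–Plancherel for the
twisted coefficients `f(n)Λ(n) n^{−iT}` and the previous lemma.
[cite: RoyVatwani2019, §6.1 display (eq:intg bound)] -/
theorem integral_norm_LSeries_mulVM_sq_div_le (f : ℕ →*₀ ℂ) (hf : ∀ n, ‖f n‖ ≤ 1) (T : ℝ) {α : ℝ}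
    (hα : 0 < α) :
    ∫ y : ℝ, ‖LSeries (fun n => f n * (Λ n : ℂ)) (1 + α + (T + y) * I)‖ ^ 2 /
        ‖(1 : ℂ) + α + y * I‖ ^ 2 ≤ 36 * π / α := by
  set a : ℕ → ℂ := fun n => f n * (Λ n : ℂ) * (n : ℂ) ^ (-(T * I)) with ha
  have hσ : (0 : ℝ) < 1 + α := by linarith
  have hP := MellinPlancherel.integral_norm_sq_psum_exp (a := a) (σ := 1 + α) (θ := 1) (C := 6) hσ
    (summable_norm_twistedFVM_div_rpow f hf T (by linarith)) (by linarith)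
    (fun y hy => norm_psum_twistedFVM_le f hf T y hy)
  have hM := meanSquare_twistedFVM_le f hf T hα
  -- identify the integrand
  have heq : (fun y : ℝ => ‖LSeries a ((1 + α : ℝ) + y * I)‖ ^ 2 / ‖(((1 + α : ℝ)) : ℂ) + y * I‖ ^ 2) =
      fun y : ℝ => ‖LSeries (fun n => f n * (Λ n : ℂ)) (1 + α + (T + y) * I)‖ ^ 2 /
        ‖(1 : ℂ) + α + y * I‖ ^ 2 := by
    funext y
    rw [ha, LSeries_twistedFVM_line f T α y]
    push_cast
    rfl
  rw [heq] at hP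
  have hπ : 0 < 2 * π := by positivity
  have h1 : (1 / (2 * π)) * ∫ y : ℝ, ‖LSeries (fun n => f n * (Λ n : ℂ)) (1 + α + (T + y) * I)‖ ^ 2 /
      ‖(1 : ℂ) + α + y * I‖ ^ 2 ≤ 18 / α := by
    rw [← hP]
    convert hM using 3
  rw [one_div, inv_mul_le_iff₀ hπ] at h1
  have h36 : 2 * π * (18 / α) = 36 * π / α := by ring
  linarith [h1]

/-- **Window mean square of `P = Σ f(n)Λ(n)n^{-s}`, uniformly in the window** (Roy–Vatwani 2019,
§6.1: "`∫_{T−1/2}^{T+1/2} |F'/F(1+α+it)|² dt ≪ α^{−1}` uniformly for `0 < α ≤ 1`", `k = 1`, with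
`F'/F = −P` for totally multiplicative `f`): for `0 < α ≤ 1` and every real `T`,
`∫_{T−1/2}^{T+1/2} |P(1+α+iy)|² dy ≤ 500/α`.
[cite: RoyVatwani2019, §6.1 (eq:(15) of MV)–(eq:intg bound)] -/
theorem window_integral_norm_LSeries_mulVM_sq_le (f : ℕ →*₀ ℂ) (hf : ∀ n, ‖f n‖ ≤ 1) {α : ℝ}
    (hα : 0 < α) (hα1 : α ≤ 1) (T : ℝ) :
    ∫ y in (T - 1 / 2)..(T + 1 / 2),
        ‖LSeries (fun n => f n * (Λ n : ℂ)) (1 + α + y * I)‖ ^ 2 ≤ 500 / α := by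
  set G : ℝ → ℝ := fun y => ‖LSeries (fun n => f n * (Λ n : ℂ)) (1 + α + (T + y) * I)‖ ^ 2 /
      ‖(1 : ℂ) + α + y * I‖ ^ 2 with hG
  -- integrability of the weighted integrand (from the tree)
  have hint : Integrable G := by
    have h := Halasz.integrable_norm_LSeries_sq_div
      (a := fun n => f n * (Λ n : ℂ) * (n : ℂ) ^ (-(T * I)))
      (σ := 1 + α) (by linarith) (summable_norm_twistedFVM_div_rpow f hf T (by linarith))
    refine h.congr (Filter.Eventually.of_forall fun y => ?_)
    simp only [hG]
    rw [LSeries_twistedFVM_line f T α y]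
    push_cast
    rfl
  have hGnn : 0 ≤ᵐ[volume] G := Filter.Eventually.of_forall fun y => by simp only [hG]; positivity
  have hwhole := integral_norm_LSeries_mulVM_sq_div_le f hf T hα
  -- shift the window to `[-1/2, 1/2]`
  set g : ℝ → ℝ := fun y => ‖LSeries (fun n => f n * (Λ n : ℂ)) (1 + α + y * I)‖ ^ 2 with hg
  have hshift : ∫ y in (T - 1 / 2)..(T + 1 / 2), g y = ∫ y in (-(1 / 2) : ℝ)..(1 / 2), g (T + y) := by
    rw [intervalIntegral.integral_comp_add_left g T, show T + -(1 / 2) = T - 1 / 2 by ring]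
  have hgT : ∀ y : ℝ, g (T + y) =
      ‖LSeries (fun n => f n * (Λ n : ℂ)) (1 + α + (T + y) * I)‖ ^ 2 := by
    intro y; simp only [hg]; push_cast; rfl
  change ∫ y in (T - 1 / 2)..(T + 1 / 2), g y ≤ 500 / α
  rw [hshift]
  simp_rw [hgT]
  -- on the window the weight is at least `4/17`
  have hptw : ∀ y ∈ Set.Icc (-(1 / 2) : ℝ) (1 / 2),
      ‖LSeries (fun n => f n * (Λ n : ℂ)) (1 + α + (T + y) * I)‖ ^ 2 ≤ (17 / 4) * G y := by
    intro y hy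
    simp only [hG]
    have hden : ‖(1 : ℂ) + α + y * I‖ ^ 2 ≤ 17 / 4 := by
      rw [Complex.sq_norm, Complex.normSq_apply]
      simp
      rw [Set.mem_Icc] at hy
      nlinarith [hy.1, hy.2]
    have hpos : 0 < ‖(1 : ℂ) + α + y * I‖ ^ 2 := by
      have : ((1 : ℂ) + α + y * I) ≠ 0 := by
        intro h
        have := congrArg Complex.re h
        simp at this
        linarith
      positivity
    rw [mul_div_assoc', le_div_iff₀ hpos]
    nlinarith [sq_nonneg ‖LSeries (fun n => f n * (Λ n : ℂ)) (1 + α + (T + y) * I)‖]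
  calc ∫ y in (-(1 / 2) : ℝ)..(1 / 2), ‖LSeries (fun n => f n * (Λ n : ℂ)) (1 + α + (T + y) * I)‖ ^ 2
      ≤ ∫ y in (-(1 / 2) : ℝ)..(1 / 2), (17 / 4) * G y := by
        refine intervalIntegral.integral_mono_on (by norm_num) ?_ ?_ hptw
        · refine (Continuous.intervalIntegrable ?_ _ _)
          have hc : Continuous fun y : ℝ =>
              LSeries (fun n => f n * (Λ n : ℂ) * (n : ℂ) ^ (-(T * I))) ((1 + α : ℝ) + y * I) :=
            Halasz.continuous_LSeries_line (summable_norm_twistedFVM_div_rpow f hf T (by linarith))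
          have heq : (fun y : ℝ => ‖LSeries (fun n => f n * (Λ n : ℂ)) (1 + α + (T + y) * I)‖ ^ 2) =
              fun y : ℝ => ‖LSeries (fun n => f n * (Λ n : ℂ) * (n : ℂ) ^ (-(T * I)))
                ((1 + α : ℝ) + y * I)‖ ^ 2 := by
            funext y
            rw [LSeries_twistedFVM_line f T α y]
          rw [heq]
          exact (hc.norm).pow 2
        · exact (hint.const_mul _).intervalIntegrable
    _ = (17 / 4) * ∫ y in (-(1 / 2) : ℝ)..(1 / 2), G y := by
        rw [intervalIntegral.integral_const_mul]
    _ ≤ (17 / 4) * ∫ y, G y := by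
        gcongr
        rw [intervalIntegral.integral_of_le (by norm_num)]
        exact setIntegral_le_integral hint hGnn
    _ ≤ (17 / 4) * (36 * π / α) := by gcongr
    _ ≤ 500 / α := by
        rw [mul_div_assoc', div_le_div_iff_of_pos_right hα]
        nlinarith [Real.pi_lt_d2]

/-! ### `F' = −P · F` on `Re s > 1` -/

/-- Twisting by a totally multiplicative `f` distributes over Dirichlet convolution (as for
Dirichlet characters, `DirichletCharacter.mul_convolution_distrib`). [folklore] -/
theorem mulHom_mul_convolution_distrib (f : ℕ →*₀ ℂ) (g₁ g₂ : ℕ → ℂ) :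
    LSeries.convolution ((f ·) * g₁) ((f ·) * g₂) = (f ·) * LSeries.convolution g₁ g₂ := by
  ext n
  simp only [Pi.mul_apply, LSeries.convolution_def, Finset.mul_sum]
  refine Finset.sum_congr rfl fun p hp => ?_
  rw [(Nat.mem_divisorsAntidiagonal.mp hp).1.symm, map_mul]
  exact mul_mul_mul_comm ..

/-- **`f(n) log n = Σ_{d | n} f(d)Λ(d) f(n/d)`** for totally multiplicative `f`
(Roy–Vatwani (eq:identity for f), `Λ_F = fΛ`): `(fΛ) ⋆ f = f · log`.
[cite: RoyVatwani2019, §6.1 (eq:identity for f)] -/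
theorem convolution_mulHom_vonMangoldt (f : ℕ →*₀ ℂ) :
    LSeries.convolution ((f ·) * fun n => (Λ n : ℂ)) (f ·) = (f ·) * fun n : ℕ => Complex.log (n : ℂ) := by
  have h := mulHom_mul_convolution_distrib f (fun n => (Λ n : ℂ)) 1
  rw [mul_one] at h
  rw [h]
  congr 1
  exact ArithmeticFunction.convolution_vonMangoldt_const_one

/-- The abscissa of absolute convergence of `F(s) = Σ f(n)n^{-s}` is `≤ 1` when `|f| ≤ 1`.
[folklore] -/
theorem abscissaOfAbsConv_mulHom_le_one (f : ℕ →*₀ ℂ) (hf : ∀ n, ‖f n‖ ≤ 1) :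
    LSeries.abscissaOfAbsConv (f ·) ≤ 1 :=
  LSeries.abscissaOfAbsConv_le_of_le_const ⟨1, fun n _ => hf n⟩

/-- `Σ f(n) n^{-s}` converges absolutely for `Re s > 1` when `|f| ≤ 1`. [folklore] -/
theorem LSeriesSummable_mulHom (f : ℕ →*₀ ℂ) (hf : ∀ n, ‖f n‖ ≤ 1) {s : ℂ} (hs : 1 < s.re) :
    LSeriesSummable (f ·) s :=
  LSeriesSummable_of_abscissaOfAbsConv_lt_re
    ((abscissaOfAbsConv_mulHom_le_one f hf).trans_lt (by exact_mod_cast hs))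

/-- `Σ f(n)Λ(n) n^{-s}` converges absolutely for `Re s > 1` when `|f| ≤ 1`. [folklore] -/
theorem LSeriesSummable_mulHom_vonMangoldt (f : ℕ →*₀ ℂ) (hf : ∀ n, ‖f n‖ ≤ 1) {s : ℂ}
    (hs : 1 < s.re) :
    LSeriesSummable ((f ·) * fun n => (Λ n : ℂ)) s := by
  have hΛ := (ArithmeticFunction.LSeriesSummable_vonMangoldt hs).norm
  rw [LSeriesSummable, ← summable_norm_iff]
  refine hΛ.of_nonneg_of_le (fun _ => norm_nonneg _) (fun n => ?_)
  rcases Nat.eq_zero_or_pos n with rfl | hn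
  · simp
  · rw [LSeries.norm_term_eq, LSeries.norm_term_eq, if_neg hn.ne', if_neg hn.ne']
    refine div_le_div_of_nonneg_right ?_ (by positivity)
    rw [Pi.mul_apply, norm_mul, Complex.norm_real, Real.norm_eq_abs,
      abs_of_nonneg ArithmeticFunction.vonMangoldt_nonneg]
    calc ‖f n‖ * Λ n ≤ 1 * Λ n :=
          mul_le_mul_of_nonneg_right (hf n) ArithmeticFunction.vonMangoldt_nonneg
      _ = Λ n := one_mul _

/-- **`F'(s) = −P(s) F(s)` for `Re s > 1`**, `F(s) = Σ f(n)n^{-s}`, `P(s) = Σ f(n)Λ(n)n^{-s}`, for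
totally multiplicative `f` with `|f| ≤ 1` ("`−F'/F(s) = Σ Λ_F(n) n^{-s}`" with `Λ_F = fΛ`).
[cite: RoyVatwani2019, §6.1 (eq:identity for f)] -/
theorem deriv_LSeries_eq_neg_mul (f : ℕ →*₀ ℂ) (hf : ∀ n, ‖f n‖ ≤ 1) {s : ℂ} (hs : 1 < s.re) :
    deriv (LSeries (f ·)) s = -(LSeries (fun n => f n * (Λ n : ℂ)) s * LSeries (f ·) s) := by
  have hs' : LSeries.abscissaOfAbsConv (f ·) < s.re :=
    (abscissaOfAbsConv_mulHom_le_one f hf).trans_lt (by exact_mod_cast hs)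
  rw [LSeries_deriv hs']
  have hconv := LSeries_convolution' (LSeriesSummable_mulHom_vonMangoldt f hf hs)
    (LSeriesSummable_mulHom f hf hs)
  rw [convolution_mulHom_vonMangoldt] at hconv
  have h1 : LSeries (LSeries.logMul (f ·)) s = LSeries ((f ·) * fun n : ℕ => Complex.log (n : ℂ)) s :=
    LSeries_congr (fun _ => by simp [mul_comm, LSeries.logMul]) s
  rw [h1, hconv]
  rfl

/-- `‖F'(s)‖ = ‖P(s)‖ · ‖F(s)‖` for `Re s > 1`. [cite: RoyVatwani2019, §6.1] -/
theorem norm_deriv_LSeries_eq (f : ℕ →*₀ ℂ) (hf : ∀ n, ‖f n‖ ≤ 1) {s : ℂ} (hs : 1 < s.re) :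
    ‖deriv (LSeries (f ·)) s‖ = ‖LSeries (fun n => f n * (Λ n : ℂ)) s‖ * ‖LSeries (f ·) s‖ := by
  rw [deriv_LSeries_eq_neg_mul f hf hs, norm_neg, norm_mul]

end Literature.NumberTheory.LFunctions.MontgomeryVaughan2001
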